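import Summits.FinalStateConjecture.FinalStateConjecture.Theorems.EIHFluxBalanceInertialRecessionStubHigherOrderTransport
import Summits.FinalStateConjecture.FinalStateConjecture.Theorems.EIHFluxBalanceInertialRecessionStubHigherOrderBoostFrame
import Summits.FinalStateConjecture.FinalStateConjecture.Theorems.EIHFluxBalanceInertialRecessionStubSlavingHelpers

/-!
# Route EIHFluxBalance — `InertialRecession` (E′), line `SketchCleanExcision`, skeleton r13,
# stub `stub_higherOrderSlaving` (EF): the representative frame and the re-centred path of one hole

Helper file for the crux `stmt-FinalStateConjecture-17403`
(`Summit.FinalStateConjecture.FinalStateConjecture.Theses.EIHFluxBalance.InertialRecession`, E′),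
registered stub `stub_higherOrderSlaving` (orders two and three of frozen-vacuum slaving).

* `higherOrder_exists_holeFrame` — for a painted hole (smooth Lorentz path `Λ`, Lorentz factor
  `≤ γ`, spin `a`) a smooth REPRESENTATIVE frame `Λ̃` painting the same Kerr–Schild field, with the
  same `4`-velocity `u = Λe₀` (and the same axis `Λe₃` if `a ≠ 0`), whose first three derivatives are
  bounded by `K e₁`, `K(e₂ + e₁²)`, `K(e₃ + e₂e₁ + e₁³)` with `e_k = ‖u⁽ᵏ⁾‖ + 𝟙[a ≠ 0] ‖(Λe₃)⁽ᵏ⁾‖`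
  (the pure boost of the lab velocity if `a = 0`, `…StubHigherOrderBoostFrame`; the untwisted frame if
  `a ≠ 0`, `…StubHigherOrderTransport`);
* `higherOrder_centrePath` — the RE-CENTRED centre path `c̃(s) = (s, ξ(s)) − ((s − t)/u⁰(t)) u(s)`
  paints the same field (`boostedKerrBilin_centre_add_smul`), passes through `(t, ξ(t))` at `s = t`,
  and has `c̃′(t) = (0, ξ′(t) − ũ(t)/u⁰(t))` (the velocity MISMATCH), `c̃″(t) = (0, ξ″(t)) − (2/u⁰(t)) u′(t)`,
  `c̃‴(t) = (0, ξ‴(t)) − (3/u⁰(t)) u″(t)`;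
* `higherOrder_labVelocity_bounds` — `‖v′‖ ≤ K‖u′‖`, `‖v″‖ ≤ K(‖u″‖ + ‖u′‖²)` for the lab velocity
  `v = ũ/u⁰` of a painted `4`-velocity.

No definitions, no named facts, no `sorry`.
-/

set_option linter.dupNamespace false
set_option maxSynthPendingDepth 6
set_option synthInstance.maxHeartbeats 200000

noncomputable section

namespace Summit.FinalStateConjecture.FinalStateConjecture.Theorems.SublinearIsFree.Slaving

open scoped Topology ContDiff
open Filter Set Function Metric Literature.Geometry.Lorentzian
  Summit.FinalStateConjecture.FinalStateConjecture.Theorems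

/-! ### The representative frame -/

set_option maxHeartbeats 1600000 in
/-- **The representative frame of a painted hole.** See the module docstring. [folklore] -/
theorem higherOrder_exists_holeFrame (Λ : ℝ → lorentzGroup) (a : ℝ) {γ : ℝ}
    (hΛ : ContDiff ℝ ∞ (fun t ↦ ((Λ t : E4 ≃L[ℝ] E4) : E4 →L[ℝ] E4)))
    (hγ : ∀ t, |((Λ t : E4 ≃L[ℝ] E4) (E4.basisVector 0)) 0| ≤ γ) :
    ∃ (Λ' : ℝ → lorentzGroup) (K : ℝ), 0 ≤ K ∧
      ContDiff ℝ ∞ (fun t ↦ ((Λ' t : E4 ≃L[ℝ] E4) : E4 →L[ℝ] E4)) ∧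
      (∀ t c M z, boostedKerrBilin (Λ' t) c M a z = boostedKerrBilin (Λ t) c M a z) ∧
      (∀ t, (Λ' t : E4 ≃L[ℝ] E4) (E4.basisVector 0) = (Λ t : E4 ≃L[ℝ] E4) (E4.basisVector 0)) ∧
      (a ≠ 0 → ∀ t, (Λ' t : E4 ≃L[ℝ] E4) (E4.basisVector 3) = (Λ t : E4 ≃L[ℝ] E4) (E4.basisVector 3)) ∧
      (∀ t, |((Λ' t : E4 ≃L[ℝ] E4) (E4.basisVector 0)) 0| ≤ γ) ∧
      ∀ t, ‖iteratedDeriv 1 (fun s ↦ ((Λ' s : E4 ≃L[ℝ] E4) : E4 →L[ℝ] E4)) t‖ ≤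
          K * (‖iteratedDeriv 1 (fun s ↦ (Λ s : E4 ≃L[ℝ] E4) (E4.basisVector 0)) t‖ +
            (if a = 0 then 0 else ‖iteratedDeriv 1 (fun s ↦ (Λ s : E4 ≃L[ℝ] E4) (E4.basisVector 3)) t‖)) ∧
        ‖iteratedDeriv 2 (fun s ↦ ((Λ' s : E4 ≃L[ℝ] E4) : E4 →L[ℝ] E4)) t‖ ≤
          K * ((‖iteratedDeriv 2 (fun s ↦ (Λ s : E4 ≃L[ℝ] E4) (E4.basisVector 0)) t‖ +
            (if a = 0 then 0 else ‖iteratedDeriv 2 (fun s ↦ (Λ s : E4 ≃L[ℝ] E4) (E4.basisVector 3)) t‖)) +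
            (‖iteratedDeriv 1 (fun s ↦ (Λ s : E4 ≃L[ℝ] E4) (E4.basisVector 0)) t‖ +
            (if a = 0 then 0 else ‖iteratedDeriv 1 (fun s ↦ (Λ s : E4 ≃L[ℝ] E4) (E4.basisVector 3)) t‖)) ^ 2) ∧
        ‖iteratedDeriv 3 (fun s ↦ ((Λ' s : E4 ≃L[ℝ] E4) : E4 →L[ℝ] E4)) t‖ ≤
          K * ((‖iteratedDeriv 3 (fun s ↦ (Λ s : E4 ≃L[ℝ] E4) (E4.basisVector 0)) t‖ +
            (if a = 0 then 0 else ‖iteratedDeriv 3 (fun s ↦ (Λ s : E4 ≃L[ℝ] E4) (E4.basisVector 3)) t‖)) +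
            (‖iteratedDeriv 2 (fun s ↦ (Λ s : E4 ≃L[ℝ] E4) (E4.basisVector 0)) t‖ +
            (if a = 0 then 0 else ‖iteratedDeriv 2 (fun s ↦ (Λ s : E4 ≃L[ℝ] E4) (E4.basisVector 3)) t‖)) *
            (‖iteratedDeriv 1 (fun s ↦ (Λ s : E4 ≃L[ℝ] E4) (E4.basisVector 0)) t‖ +
            (if a = 0 then 0 else ‖iteratedDeriv 1 (fun s ↦ (Λ s : E4 ≃L[ℝ] E4) (E4.basisVector 3)) t‖)) +
            (‖iteratedDeriv 1 (fun s ↦ (Λ s : E4 ≃L[ℝ] E4) (E4.basisVector 0)) t‖ +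
            (if a = 0 then 0 else ‖iteratedDeriv 1 (fun s ↦ (Λ s : E4 ≃L[ℝ] E4) (E4.basisVector 3)) t‖)) ^ 3) := by
  by_cases ha : a = 0
  · subst ha
    obtain ⟨Λ', K, hK, hs, hpaint, hcol, hb⟩ := higherOrder_exists_boostFrame Λ hΛ hγ
    refine ⟨Λ', K, hK, hs, hpaint, hcol, fun h ↦ absurd rfl h, fun t ↦ by rw [hcol t]; exact hγ t,
      fun t ↦ ?_⟩
    simp only [if_true, add_zero]
    exact hb t
  · obtain ⟨Λ', K, hK, hs, hpaint, hcol, hcol3, hb⟩ := higherOrder_exists_transportFrame Λ hΛ hγ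
    refine ⟨Λ', K, hK, hs, fun t c M z ↦ hpaint t c M a z, hcol, fun _ ↦ hcol3,
      fun t ↦ by rw [hcol t]; exact hγ t, fun t ↦ ?_⟩
    simp only [ha, if_false]
    exact hb t

/-! ### The lab velocity along a painted `4`-velocity -/

/-- **Bounds for the derivatives of the lab velocity** `v = ũ/u⁰` of a unit timelike path with
Lorentz factor `≤ γ`, uniformly: `‖v′‖ ≤ K‖u′‖`, `‖v″‖ ≤ K(‖u″‖ + ‖u′‖²)`, and `v` is smooth.
[folklore] -/
theorem higherOrder_labVelocity_bounds (γ : ℝ) : ∃ K : ℝ, 0 ≤ K ∧ ∀ (u : ℝ → E4),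
    ContDiff ℝ ∞ u → (∀ t, Minkowski.bilin (u t) (u t) = -1) → (∀ t, |u t 0| ≤ γ) →
    ContDiff ℝ ∞ (fun s ↦ ((u s) 0)⁻¹ • E4.spatial (u s)) ∧ ∀ t,
      ‖deriv (fun s ↦ ((u s) 0)⁻¹ • E4.spatial (u s)) t‖ ≤ K * ‖deriv u t‖ ∧
      ‖iteratedDeriv 2 (fun s ↦ ((u s) 0)⁻¹ • E4.spatial (u s)) t‖ ≤
        K * (‖iteratedDeriv 2 u t‖ + ‖deriv u t‖ ^ 2) := by
  set O : Set E4 := {w : E4 | w 0 ≠ 0} with hO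
  have hOo : IsOpen O := isOpen_ne_fun (EuclideanSpace.proj (0 : Fin 4)).continuous continuous_const
  have hψ : ContDiffOn ℝ ∞ (fun w : E4 ↦ (w 0)⁻¹ • E4.spatial w) O :=
    fun w hw ↦ (contDiffAt_labVelocityMap hw).contDiffWithinAt
  have hKc := higherOrder_isCompact_unitTimelike γ
  have hKO : {w : E4 | Minkowski.bilin w w = -1 ∧ |w 0| ≤ γ} ⊆ O := fun w hw ↦
    (higherOrder_unitTimelike_facts hw.1).2.1
  obtain ⟨C, hC0, hC⟩ := exists_forall_norm_iteratedFDeriv_le_of_isCompact hOo hψ hKc hKO 3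
  refine ⟨C, hC0, fun u hu hunit hγ ↦ ?_⟩
  have hmem : ∀ t, u t ∈ {w : E4 | Minkowski.bilin w w = -1 ∧ |w 0| ≤ γ} := fun t ↦ ⟨hunit t, hγ t⟩
  have hcomp : (fun s ↦ ((u s) 0)⁻¹ • E4.spatial (u s)) = (fun w : E4 ↦ (w 0)⁻¹ • E4.spatial w) ∘ u := rfl
  refine ⟨by rw [hcomp]; exact hψ.comp_contDiff hu fun t ↦ hKO (hmem t), fun t ↦ ?_⟩
  have hb := higherOrder_norm_deriv_comp₃_le hOo hψ hu (hKO (hmem t))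
    (hC (u t) (hmem t) 1 (by norm_num)) (hC (u t) (hmem t) 2 (by norm_num)) (hC (u t) (hmem t) 3 le_rfl)
  rw [← hcomp] at hb
  exact ⟨hb.1, hb.2.2.2.1⟩

/-! ### The re-centred centre path -/

set_option maxHeartbeats 1600000 in
/-- **The re-centred centre path of a painted hole.** For a smooth Lorentz path `Λ` (`u = Λe₀`), a
smooth centre curve `ξ` and a base time `t`, the path `c̃(s) = (s, ξ(s)) − ((s − t)/u⁰(t)) u(s)` is
smooth, paints the same Kerr–Schild field as `(s, ξ(s))`, passes through `(t, ξ(t))` at `s = t`, and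
`c̃′(t) = (0, ξ′(t) − ũ(t)/u⁰(t))`, `c̃″(t) = (0, ξ″(t)) − (2/u⁰(t)) u′(t)`,
`c̃‴(t) = (0, ξ‴(t)) − (3/u⁰(t)) u″(t)`. [folklore] -/
theorem higherOrder_centrePath (Λ : ℝ → lorentzGroup) {ξ : ℝ → E3}
    (hΛ : ContDiff ℝ ∞ (fun t ↦ ((Λ t : E4 ≃L[ℝ] E4) : E4 →L[ℝ] E4))) (hξ : ContDiff ℝ ∞ ξ)
    (M a t : ℝ) :
    let u : ℝ → E4 := fun s ↦ (Λ s : E4 ≃L[ℝ] E4) (E4.basisVector 0)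
    let cc : ℝ → E4 := fun s ↦ E4.ofTimeSpace s (ξ s) - ((s - t) * (u t 0)⁻¹) • u s
    ContDiff ℝ ∞ cc ∧ cc t = E4.ofTimeSpace t (ξ t) ∧
    (∀ s z, boostedKerrBilin (Λ s) (E4.ofTimeSpace s (ξ s)) M a z = boostedKerrBilin (Λ s) (cc s) M a z) ∧
    deriv cc t = E4.spaceEmbed (deriv ξ t - ((u t) 0)⁻¹ • E4.spatial (u t)) ∧
    iteratedDeriv 2 cc t = E4.spaceEmbed (iteratedDeriv 2 ξ t) - (2 * (u t 0)⁻¹) • deriv u t ∧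
    iteratedDeriv 3 cc t = E4.spaceEmbed (iteratedDeriv 3 ξ t) - (3 * (u t 0)⁻¹) • iteratedDeriv 2 u t := by
  intro u cc
  have hus : ContDiff ℝ ∞ u := hΛ.clm_apply contDiff_const
  set κ : ℝ := (u t 0)⁻¹ with hκ
  -- the centre event path `s ↦ (s, ξ s) = s • e₀ + spaceEmbed (ξ s)`
  set ce : ℝ → E4 := fun s ↦ E4.ofTimeSpace s (ξ s) with hce
  have hce_eq : ce = fun s ↦ s • E4.basisVector 0 + E4.spaceEmbed (ξ s) :=
    funext fun s ↦ E4.ofTimeSpace_eq_smul_add' _ _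
  have hces : ContDiff ℝ ∞ ce := by
    rw [hce_eq]; exact (contDiff_id.smul contDiff_const).add (E4.spaceEmbed.contDiff.comp hξ)
  -- the correction `s ↦ ((s - t) κ) • u s`
  set g : ℝ → ℝ := fun s ↦ (s - t) * κ with hg
  have hgs : ContDiff ℝ ∞ g := (contDiff_id.sub contDiff_const).mul contDiff_const
  have hcorr : ContDiff ℝ ∞ (fun s ↦ g s • u s) := hgs.smul hus
  have hccs : ContDiff ℝ ∞ cc := hces.sub hcorr
  -- derivatives of the pieces
  have hdξ : ∀ s, HasDerivAt ξ (deriv ξ s) s := fun s ↦ (hξ.differentiable (by simp) s).hasDerivAt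
  have hdξ1 : ∀ s, HasDerivAt (deriv ξ) (iteratedDeriv 2 ξ s) s := fun s ↦ by
    have h := higherOrder_hasDerivAt_iteratedDeriv hξ 1 s; rwa [iteratedDeriv_one] at h
  have hdξ2 : ∀ s, HasDerivAt (iteratedDeriv 2 ξ) (iteratedDeriv 3 ξ s) s := fun s ↦
    higherOrder_hasDerivAt_iteratedDeriv hξ 2 s
  have hdu : ∀ s, HasDerivAt u (deriv u s) s := fun s ↦ (hus.differentiable (by simp) s).hasDerivAt
  have hdu1 : ∀ s, HasDerivAt (deriv u) (iteratedDeriv 2 u s) s := fun s ↦ by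
    have h := higherOrder_hasDerivAt_iteratedDeriv hus 1 s; rwa [iteratedDeriv_one] at h
  have hdu2 : ∀ s, HasDerivAt (iteratedDeriv 2 u) (iteratedDeriv 3 u s) s := fun s ↦
    higherOrder_hasDerivAt_iteratedDeriv hus 2 s
  have hdg : ∀ s, HasDerivAt g κ s := fun s ↦ by
    simpa using ((hasDerivAt_id s).sub_const t).mul_const κ
  -- `ce′ = e₀ + spaceEmbed ξ′`, `ce″ = spaceEmbed ξ″`, `ce‴ = spaceEmbed ξ‴`
  have hce1 : ∀ s, HasDerivAt ce (E4.basisVector 0 + E4.spaceEmbed (deriv ξ s)) s := fun s ↦ by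
    rw [hce_eq]
    have h1 : HasDerivAt (fun s : ℝ ↦ s • (E4.basisVector 0 : E4)) ((1 : ℝ) • E4.basisVector 0) s :=
      (hasDerivAt_id s).smul_const _
    rw [one_smul] at h1
    exact h1.add (E4.spaceEmbed.hasFDerivAt.comp_hasDerivAt s (hdξ s))
  have hce1f : deriv ce = fun s ↦ E4.basisVector 0 + E4.spaceEmbed (deriv ξ s) := funext fun s ↦ (hce1 s).deriv
  have hce2 : ∀ s, HasDerivAt (deriv ce) (E4.spaceEmbed (iteratedDeriv 2 ξ s)) s := fun s ↦ by
    rw [hce1f]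
    simpa using (E4.spaceEmbed.hasFDerivAt.comp_hasDerivAt s (hdξ1 s)).const_add (E4.basisVector 0)
  have hce2f : iteratedDeriv 2 ce = fun s ↦ E4.spaceEmbed (iteratedDeriv 2 ξ s) := by
    rw [iteratedDeriv_succ, iteratedDeriv_one]; exact funext fun s ↦ (hce2 s).deriv
  have hce3 : HasDerivAt (iteratedDeriv 2 ce) (E4.spaceEmbed (iteratedDeriv 3 ξ t)) t := by
    rw [hce2f]; exact E4.spaceEmbed.hasFDerivAt.comp_hasDerivAt t (hdξ2 t)
  -- the correction: `(g u)′ = g u′ + κ u`, `(g u)″ = g u″ + 2κ u′`, `(g u)‴(t) = 3κ u″(t)` (`g(t) = 0`)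
  have hk1 : ∀ s, HasDerivAt (fun s ↦ g s • u s) (g s • deriv u s + κ • u s) s := fun s ↦
    (hdg s).smul (hdu s)
  have hk1f : deriv (fun s ↦ g s • u s) = fun s ↦ g s • deriv u s + κ • u s := funext fun s ↦ (hk1 s).deriv
  have hk2 : ∀ s, HasDerivAt (deriv (fun s ↦ g s • u s))
      ((g s • iteratedDeriv 2 u s + κ • deriv u s) + κ • deriv u s) s := fun s ↦ by
    rw [hk1f]; exact ((hdg s).smul (hdu1 s)).add ((hdu s).const_smul κ)
  have hk2f : iteratedDeriv 2 (fun s ↦ g s • u s) = fun s ↦ (g s • iteratedDeriv 2 u s + κ • deriv u s) + κ • deriv u s := by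
    rw [iteratedDeriv_succ, iteratedDeriv_one]; exact funext fun s ↦ (hk2 s).deriv
  have hk3 : HasDerivAt (iteratedDeriv 2 (fun s ↦ g s • u s))
      (((g t • iteratedDeriv 3 u t + κ • iteratedDeriv 2 u t) + κ • iteratedDeriv 2 u t) + κ • iteratedDeriv 2 u t) t := by
    rw [hk2f]
    exact (((hdg t).smul (hdu2 t)).add ((hdu1 t).const_smul κ)).add ((hdu1 t).const_smul κ)
  have hgt : g t = 0 := by simp [hg]
  -- assemble the derivatives of `cc = ce − g • u`
  have hccfun : cc = fun s ↦ ce s - g s • u s := rfl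
  have hu0 : u t 0 ≠ 0 := fun h ↦ by
    have := one_le_abs_lorentz_apply_zero (Λ t)
    change 1 ≤ |u t 0| at this
    rw [h, abs_zero] at this; exact absurd this (by norm_num)
  have hD1 : ∀ s, HasDerivAt cc ((E4.basisVector 0 + E4.spaceEmbed (deriv ξ s)) - (g s • deriv u s + κ • u s)) s :=
    fun s ↦ by rw [hccfun]; exact (hce1 s).fun_sub (hk1 s)
  have hD1f : deriv cc = fun s ↦ (E4.basisVector 0 + E4.spaceEmbed (deriv ξ s)) - (g s • deriv u s + κ • u s) :=
    funext fun s ↦ (hD1 s).deriv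
  have hD2 : ∀ s, HasDerivAt (deriv cc) (E4.spaceEmbed (iteratedDeriv 2 ξ s) -
      ((g s • iteratedDeriv 2 u s + κ • deriv u s) + κ • deriv u s)) s := fun s ↦ by
    rw [hD1f]
    have h1 := hce2 s
    rw [hce1f] at h1
    have h2 := hk2 s
    rw [hk1f] at h2
    exact h1.fun_sub h2
  have hD2f : iteratedDeriv 2 cc = fun s ↦ E4.spaceEmbed (iteratedDeriv 2 ξ s) -
      ((g s • iteratedDeriv 2 u s + κ • deriv u s) + κ • deriv u s) := by
    rw [iteratedDeriv_succ, iteratedDeriv_one]; exact funext fun s ↦ (hD2 s).deriv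
  have hD3 : HasDerivAt (iteratedDeriv 2 cc) (E4.spaceEmbed (iteratedDeriv 3 ξ t) -
      (((g t • iteratedDeriv 3 u t + κ • iteratedDeriv 2 u t) + κ • iteratedDeriv 2 u t) + κ • iteratedDeriv 2 u t)) t := by
    rw [hD2f]
    have h1 := hce3
    rw [hce2f] at h1
    have h2 := hk3
    rw [hk2f] at h2
    exact h1.fun_sub h2
  have hd1 : deriv cc t = E4.spaceEmbed (deriv ξ t - ((u t) 0)⁻¹ • E4.spatial (u t)) := by
    rw [(hD1 t).deriv, hgt, zero_smul, zero_add]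
    -- `κ • u t = e₀ + spaceEmbed (κ • ũ)`
    have hut : u t = E4.ofTimeSpace (u t 0) (E4.spatial (u t)) := (E4.ofTimeSpace_time_spatial _).symm
    have hκu : κ • u t = E4.basisVector 0 + E4.spaceEmbed (κ • E4.spatial (u t)) := by
      conv_lhs => rw [hut]
      rw [E4.ofTimeSpace_eq_smul_add', smul_add, smul_smul, hκ, inv_mul_cancel₀ hu0, one_smul,
        ← map_smul]
    rw [hκu, map_sub, map_smul]
    abel
  have hd2 : iteratedDeriv 2 cc t = E4.spaceEmbed (iteratedDeriv 2 ξ t) - (2 * (u t 0)⁻¹) • deriv u t := by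
    rw [hD2f]
    simp only [hgt, zero_smul, zero_add, mul_smul, two_smul, ← hκ]
  have hd3 : iteratedDeriv 3 cc t = E4.spaceEmbed (iteratedDeriv 3 ξ t) - (3 * (u t 0)⁻¹) • iteratedDeriv 2 u t := by
    rw [iteratedDeriv_succ, hD3.deriv]
    simp only [hgt, zero_smul, zero_add, mul_smul, ← hκ]
    rw [show (3 : ℝ) • κ • iteratedDeriv 2 u t =
      κ • iteratedDeriv 2 u t + κ • iteratedDeriv 2 u t + κ • iteratedDeriv 2 u t by
      rw [show (3 : ℝ) = 1 + 1 + 1 by norm_num, add_smul, add_smul, one_smul]]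
  refine ⟨hccs, ?_, fun s z ↦ ?_, hd1, hd2, hd3⟩
  · show E4.ofTimeSpace t (ξ t) - ((t - t) * κ) • u t = E4.ofTimeSpace t (ξ t)
    rw [sub_self, zero_mul, zero_smul, sub_zero]
  · show boostedKerrBilin (Λ s) (E4.ofTimeSpace s (ξ s)) M a z =
      boostedKerrBilin (Λ s) (E4.ofTimeSpace s (ξ s) - ((s - t) * κ) • u s) M a z
    have h := boostedKerrBilin_centre_add_smul (Λ s) (E4.ofTimeSpace s (ξ s) - ((s - t) * κ) • u s)
      ((s - t) * κ) M a z
    rw [← h]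
    congr 1
    show E4.ofTimeSpace s (ξ s) = E4.ofTimeSpace s (ξ s) - ((s - t) * κ) • u s + ((s - t) * κ) • u s
    abel

/-- **Registered one-line carrier form** (`higherOrder_centrePath_EF`) of `higherOrder_centrePath`.
[folklore] -/
theorem higherOrder_centrePath_EF : open Literature.Geometry.Lorentzian in ∀ (Λ : ℝ → lorentzGroup) {ξ : ℝ → E3}, ContDiff ℝ ((⊤ : ℕ∞) : WithTop ℕ∞) (fun t ↦ ((Λ t : E4 ≃L[ℝ] E4) : E4 →L[ℝ] E4)) → ContDiff ℝ ((⊤ : ℕ∞) : WithTop ℕ∞) ξ → ∀ (M a t : ℝ), let u : ℝ → E4 := fun s ↦ (Λ s : E4 ≃L[ℝ] E4) (E4.basisVector 0); let cc : ℝ → E4 := fun s ↦ E4.ofTimeSpace s (ξ s) - ((s - t) * (u t 0)⁻¹) • u s; ContDiff ℝ ((⊤ : ℕ∞) : WithTop ℕ∞) cc ∧ cc t = E4.ofTimeSpace t (ξ t) ∧ (∀ s z, boostedKerrBilin (Λ s) (E4.ofTimeSpace s (ξ s)) M a z = boostedKerrBilin (Λ s) (cc s) M a z) ∧ deriv cc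 t = E4.spaceEmbed (deriv ξ t - ((u t) 0)⁻¹ • E4.spatial (u t)) ∧ iteratedDeriv 2 cc t = E4.spaceEmbed (iteratedDeriv 2 ξ t) - (2 * (u t 0)⁻¹) • deriv u t ∧ iteratedDeriv 3 cc t = E4.spaceEmbed (iteratedDeriv 3 ξ t) - (3 * (u t 0)⁻¹) • iteratedDeriv 2 u t :=
  fun Λ _ hΛ hξ M a t ↦ higherOrder_centrePath Λ hΛ hξ M a t

end Summit.FinalStateConjecture.FinalStateConjecture.Theorems.SublinearIsFree.Slaving

end
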